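import Summits.FinalStateConjecture.FinalStateConjecture.Theorems.ExactKerrEndsCensorshipAlongKerrEndsMinkowskiCensored
import Summits.FinalStateConjecture.FinalStateConjecture.Theorems.ExactKerrEndsSettlingAlongCensoredKerrEndsFromSummit
import Summits.FinalStateConjecture.FinalStateConjecture.Theorems.UniversalWitnessFamily.Negative.MinkowskiSettled
import Summits.FinalStateConjecture.FinalStateConjecture.Theorems.ClusterCompletenessOmegaLimitMultiKerrT2Defs
import Summits.FinalStateConjecture.FinalStateConjecture.Theorems.ZeroEnergyKerrOrBombStationaryLimitReductionOneDevelopment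
import Literature.Geometry.Lorentzian.MinkowskiCauchyGraph
import Literature.Geometry.Lorentzian.NormalisedNullRayCausal
import HarnessLib

/-!
# Crux `SettlingAlongCensoredKerrEnds` (stmt-FinalStateConjecture-18520, route `ExactKerrEnds`):
# a datum with a Cauchy development WHICH IS Minkowski space, its slice below a hyperplane, is SETTLED

Write `Settled D` for the conclusion clause of the crux `C₂ = SettlingAlongCensoredKerrEnds` at `D`
(verbatim the `∀`-MGHD conjunct of the summit; `ClusterCompleteness.SettlesT2` per development): every
maximal vacuum Cauchy development of `D` has complete `𝓘⁺` (sojourn form) and carries a `C²`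
sub-extremal `N`-Kerr `FinalStateDecomposition` of `O = exteriorOf` with `RaysStayInClosure`,
`HasExhaustiveCharts`, `IsFutureOriented`. This file is the `N = 0` (dispersal) companion of the `C₁`
lemma `censored_of_cauchyDevelopment_eq_minkowski` (`…CensorshipAlongKerrEndsMinkowskiCensored.lean`) and
frees the model point (every MGHD of the trivial datum `(ℝ³, δ, 0)` settles) from the slice `{t = 0}`:

* `exists_lateFlatDecomp` — for every region `O ⊆ ℝ⁴` containing a late half-space `{x⁰ > T}` the
  identity flat chart after `τ₀ = T` is an honest, EXHAUSTIVE, FUTURE-ORIENTED `N = 0` final-state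
  decomposition of `O` in Minkowski space, charting `{x⁰ > T}`;
* `lateHalfSpace_subset_causalFuture` — a Cauchy hypersurface `S` of Minkowski space below the
  hyperplane `{x⁰ = T}` has `{x⁰ > T} ⊆ J⁺(S)` (`S` is an entire Lipschitz graph);
* `raysStayInClosure_of_causalFuture_subset` — in ANY Cauchy development, normalised null rays from
  the data stay in every region whose closure contains `J⁺(ι X)`;
* `settlesT2_of_toSpacetime_eq_minkowski` — a vacuum Cauchy development WHICH IS Minkowski space,
  w.r.t. ANY data hypersurface `ι(X)` (an arbitrary Cauchy hypersurface of `(ℝ⁴, η)`) below some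
  hyperplane `{x⁰ = T}`, settles in the full T2 sense with `O = J⁺(ι X)`, `N = 0`;
* `settled_of_cauchyDevelopment_eq_minkowski` — **main result: a datum with such a Cauchy development
  is SETTLED**: every maximal vacuum Cauchy development is isometric, as a development, to the
  Minkowskian one (`IsMaximal.isIsometricTo_of_isGeodesicallyComplete`, O'Neill 1983, Cor. 7.29) and
  the T2 package with `O = J⁺(ι X)` rides along isometries of developments
  (`settlesT2_of_isIsometricTo_of_causalFuture`, assembled from the tree's built transport
  `OneLockedExplosion.transportDecomposition` / `image_exteriorOf` / `image_causalFuture_eq` /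
  `hasExhaustiveCharts_transportDecomposition` and `hasCompleteNullInfinity_iff_of_isIsometricTo`; the
  ray clause is automatic for `O = J⁺(ι X)`); the model point `TrivialDatum.settlesT2_of_isMaximal`
  is its case `ι = {t = 0}`, `T = 0`;
* `exists_settledCurve_of_cauchyDevelopment_eq_minkowski` — hence the CONSEQUENT of `C₂` at every
  input curve whose base is admissible with such a development: through the base passes a tame,
  injective, immersed curve of admissible data with settled members (`settledSelfWitness`).

Scope (recorded, not claimed): "slice below a hyperplane" is exactly what makes the IDENTITY flat chart
a late chart into `O = J⁺(ι X)` (`{x⁰ > τ₀} ⊆ J⁺(ι X)` iff the graph function is `≤ τ₀`); admissible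
Minkowskian data whose slice is unbounded above in `x⁰` (e.g. `t = (log r)^{1/2}` far out, still
`o₂(r⁻¹)`/`o₁(r⁻²)`) need a bent flat chart and are not treated; every other base of `C₂` is the
large-data final-state problem. No `sorry`, no definition, no named fact.
References: Christodoulou–Klainerman 1993, Thm. 1.0.2; O'Neill 1983, Ch. 7, Cor. 7.29 and Ch. 14,
p. 402, Def. 14.28; Beig–Chruściel, J. Math. Phys. 37 (1996), proof of Thm. 4.1; Dafermos–Luk,
arXiv:1710.01722, Conjecture 1; Choquet-Bruhat–Geroch, CMP 14 (1969), Thm. 3.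
-/

set_option linter.dupNamespace false

noncomputable section

open Set Function Filter TopologicalSpace
open scoped Manifold ContDiff Topology

namespace Summit.FinalStateConjecture.FinalStateConjecture.Theorems.ExactKerrEnds

open Literature.Geometry.Lorentzian
open Summit.FinalStateConjecture (HasCompleteNullInfinity exteriorOf RaysStayInClosure HasExhaustiveCharts IsFutureOriented)
open Summit.FinalStateConjecture.FinalStateConjecture.Theorems.UniversalWitnessFamily.Negative
  (idFlatChart image_idFlatChart_lateRegion image_idFlatChart_timeSlab deviationExtend_idFlatChart
    chronologicalPast_late)
open Summit.FinalStateConjecture.FinalStateConjecture.Theorems.ClusterCompleteness (SettlesT2)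
open Summit.FinalStateConjecture.FinalStateConjecture.Theorems.OneLockedExplosion
  (transportDecomposition charted_transportDecomposition mdifferentiable_diffeomorph image_exteriorOf
    image_causalFuture_eq hasExhaustiveCharts_transportDecomposition)
open Summit.FinalStateConjecture.FinalStateConjecture.Theorems.PhaseMixingCapture.WeakCosmicCensorshipMGHD
  (hasCompleteNullInfinity_iff_of_isIsometricTo)

/-! ## §1 The identity flat chart after time `T` decomposes every region containing `{x⁰ > T}` -/

/-- The identity flat chart of Minkowski space is a late-time chart after `τ₀ = T` into every region
`O` containing the late half-space `{x⁰ > T}`. [cite: arXiv210408222, §1] -/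
theorem isLateChart_idFlatChart_of_subset {O : Set E4} {T : ℝ} (hO : {x : E4 | T < x 0} ⊆ O) :
    Minkowski.spacetime.IsLateChart (Minkowski.backgroundOn ⊤) O T idFlatChart := by
  refine ⟨contMDiff_subtype_val, ?_, ?_⟩
  · have hlate : IsOpen ((Minkowski.backgroundOn ⊤).lateRegion T) :=
      isOpen_lt continuous_const ((PiLp.continuous_apply 2 _ 0).comp continuous_subtype_val)
    exact (IsOpen.isOpenEmbedding_subtypeVal (⊤ : Opens E4).isOpen).comp
      (IsOpen.isOpenEmbedding_subtypeVal hlate)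
  · intro x hx
    have hx' : x ∈ (idFlatChart '' (Minkowski.backgroundOn ⊤).lateRegion T : Set E4) := hx
    rw [image_idFlatChart_lateRegion] at hx'
    exact hO hx'

/-- **The honest `N = 0` decomposition of any region `O ⊇ {x⁰ > T}` of Minkowski space by the
identity flat chart after `τ₀ = T`**: no hole, flat domain `E4`, zero `C²` deviation, charted late region
`{x⁰ > T}`; it EXHAUSTS `O` (a point not flat-late after `τ₁` has `x⁰ ≤ τ₁` and lies under the certified
slab `{x⁰ = τ₁}`, vertical segment) and is FUTURE-ORIENTED (`∂₀ ↦ ∂ₜ`). [cite: ChristodoulouKlainerman1993, Thm. 1.0.2] -/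
theorem exists_lateFlatDecomp (O : Set E4) (T : ℝ) (hO : {x : E4 | T < x 0} ⊆ O) :
    ∃ d : FinalStateDecomposition Minkowski.spacetime O 2,
      d.N = 0 ∧ d.charted = {x : E4 | T < x 0} ∧ HasExhaustiveCharts d ∧ IsFutureOriented d := by
  -- vertical segments: a point not later than `τ` lies in the causal past of the flat slab `{x⁰ = τ}`
  have hunder : ∀ (τ : ℝ) (x : E4), x 0 ≤ τ →
      x ∈ Minkowski.spacetime.metric.causalPast Minkowski.spacetime.timeOrientation
        (idFlatChart '' (Minkowski.backgroundOn ⊤).timeSlab τ) := by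
    intro τ x hxle
    have hJ : x ∈ Minkowski.spacetime.metric.causalPast Minkowski.spacetime.timeOrientation
        ({E4.ofTimeSpace τ (E4.spatial x)} : Set E4) := by
      refine Minkowski.mem_causalPast_vacuumCauchyDevelopment ?_
      simp only [E4.spatial_ofTimeSpace, sub_self, norm_zero, E4.ofTimeSpace_apply_zero, sub_nonneg]
      exact hxle
    refine LorentzianMetric.causalFuture_mono (M := Minkowski.spacetime.carrier) ?_ hJ
    refine singleton_subset_iff.mpr ?_
    have : E4.ofTimeSpace τ (E4.spatial x) ∈
        (idFlatChart '' (Minkowski.backgroundOn ⊤).timeSlab τ : Set E4) := by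
      rw [image_idFlatChart_timeSlab]
      exact E4.ofTimeSpace_apply_zero τ _
    exact this
  -- not flat-late after `τ` means `x⁰ ≤ τ`
  have hnotlate : ∀ (τ : ℝ) (x : E4),
      x ∉ (idFlatChart '' (Minkowski.backgroundOn ⊤).lateRegion τ : Set E4) → x 0 ≤ τ := by
    intro τ x hx
    refine not_lt.mp fun hlt ↦ hx ?_
    have : x ∈ (idFlatChart '' (Minkowski.backgroundOn ⊤).lateRegion τ : Set E4) := by
      rw [image_idFlatChart_lateRegion]
      exact hlt
    exact this
  have hcharted0 : ∀ {O' : Set Minkowski.spacetime.carrier}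
      (d : FinalStateDecomposition Minkowski.spacetime O' 2), d.N = 0 → d.charted = d.radiationZone := by
    intro O' d hN
    haveI : IsEmpty (Fin d.N) := by
      rw [hN]
      exact Fin.isEmpty'
    rw [FinalStateDecomposition.charted, iUnion_of_empty, union_empty]
  refine ⟨{ N := 0
            mass := Fin.elim0
            spin := Fin.elim0
            mass_pos := fun i ↦ i.elim0
            abs_spin_le_mass := fun i ↦ i.elim0
            motion := Fin.elim0
            τ₀ := T
            chart := fun i ↦ i.elim0
            isLateChart := fun i ↦ i.elim0
            tendsto_truncDeviationCk := fun i ↦ i.elim0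
            exists_pairwise_disjoint := fun _ ↦ ⟨0, fun i ↦ i.elim0⟩
            excision := Fin.elim0
            tendsto_excision_div := fun i ↦ i.elim0
            flatDomain := ⊤
            setOf_lt_excision_subset_flatDomain := fun _ _ ↦ trivial
            flatChart := idFlatChart
            isLateChart_flat := isLateChart_idFlatChart_of_subset hO
            tendsto_deviationCk_flat := by
              have h : ∀ τ, Minkowski.spacetime.deviationCk (Minkowski.backgroundOn ⊤) idFlatChart 2 τ
                  = 0 := fun τ ↦ by
                rw [Spacetime.deviationCk, deviationExtend_idFlatChart, supCkENorm_zero]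
              simp_rw [h]
              exact tendsto_const_nhds
            diff_subset_causalPast := by
              intro x hx
              refine LorentzianMetric.causalFuture_mono (M := Minkowski.spacetime.carrier)
                subset_union_right (hunder T x (hnotlate T x fun h ↦ hx.2 (Or.inr h))) },
    rfl, ?_, ?_, ?_⟩
  · -- the charted late region is `{x⁰ > T}`
    rw [hcharted0 _ rfl]
    exact image_idFlatChart_lateRegion T
  · -- exhaustive: no hole, and under every certified flat slab lies everything not later than it
    refine ⟨Fin.elim0, fun i ↦ i.elim0, fun i ↦ i.elim0, ?_⟩
    rintro τ₁ - x hx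
    exact LorentzianMetric.causalFuture_mono (M := Minkowski.spacetime.carrier)
      subset_union_left (hunder τ₁ x (hnotlate τ₁ x fun h ↦ hx.2 (Or.inl h)))
  · -- future-oriented: the identity chart pushes `∂₀` to the orienting field `∂ₜ`
    refine ⟨fun i ↦ i.elim0, fun i ↦ i.elim0, ?_⟩
    change ∀ᶠ τ in atTop, ∀ x ∈ (Minkowski.backgroundOn ⊤).timeSlab τ,
      Minkowski.spacetime.timeOrientation.IsFutureDirected
        (mfderiv 𝓘(ℝ, E4) (𝓡 4) idFlatChart x (E4.basisVector 0))
    refine Filter.Eventually.of_forall fun τ x _ ↦ ?_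
    have hd : mfderiv 𝓘(ℝ, E4) (𝓡 4) idFlatChart x (E4.basisVector 0) = E4.basisVector 0 := by
      change mfderiv 𝓘(ℝ, E4) 𝓘(ℝ, E4) (Subtype.val : (⊤ : Opens E4) → E4) x (E4.basisVector 0) = _
      rw [mfderiv_subtypeVal]
      rfl
    rw [hd]
    exact Minkowski.spacetime.timeOrientation.isFutureDirected_vectorField (x : E4)

/-! ## §2 A Cauchy hypersurface below a hyperplane; rays stay in `J⁺(ι X)` -/

/-- **A Cauchy hypersurface of Minkowski space lying below the hyperplane `{x⁰ = T}` has the late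
half-space `{x⁰ > T}` in its causal future**: it is the entire graph of a (`1`-Lipschitz) function
`u ≤ T` (`Minkowski.IsCauchyHypersurface.exists_lipschitzWith_eq_range_graph`), and `(x⁰, x̲)` lies
vertically above the graph point `(u(x̲), x̲)`. [cite: BeigChrusciel1996, proof of Thm. 4.1, §4 (last paragraph)] -/
theorem lateHalfSpace_subset_causalFuture {S : Set E4}
    (hS : Minkowski.spacetime.metric.IsCauchyHypersurface Minkowski.spacetime.timeOrientation S)
    {T : ℝ} (hT : ∀ x ∈ S, x 0 ≤ T) :
    {x : E4 | T < x 0} ⊆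
      Minkowski.spacetime.metric.causalFuture Minkowski.spacetime.timeOrientation S := by
  obtain ⟨u, -, hSu⟩ := Minkowski.IsCauchyHypersurface.exists_lipschitzWith_eq_range_graph hS
  intro x hx
  have hpS : E4.ofTimeSpace (u (E4.spatial x)) (E4.spatial x) ∈ S := by
    rw [hSu]
    exact ⟨E4.spatial x, rfl⟩
  have hu : u (E4.spatial x) ≤ T := by
    have := hT _ hpS
    rwa [E4.ofTimeSpace_apply_zero] at this
  have hJ : x ∈ Minkowski.spacetime.metric.causalFuture Minkowski.spacetime.timeOrientation
      ({E4.ofTimeSpace (u (E4.spatial x)) (E4.spatial x)} : Set E4) := by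
    refine Minkowski.mem_causalFuture_vacuumCauchyDevelopment ?_
    rw [E4.spatial_ofTimeSpace, sub_self, norm_zero, E4.ofTimeSpace_apply_zero, sub_nonneg]
    exact hu.trans (le_of_lt hx)
  exact LorentzianMetric.causalFuture_mono (M := Minkowski.spacetime.carrier)
    (singleton_subset_iff.mpr hpS) hJ

section AnyDevelopment

variable {X : Type} [TopologicalSpace X] [ChartedSpace E3 X] [IsManifold (𝓡 3) ∞ X]
  [ConnectedSpace X] {D : InitialDataSet (𝓡 3) X}

/-- **Normalised null rays from the data stay in every region whose closure contains `J⁺(ι X)`**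
(any Cauchy development): a normalised ray is a future causal curve from `ι p`, so its points of
parameter `t ≥ 0` lie in `J⁺(ι X)` (`IsNormalisedNullRayFrom.mem_causalFuture_range`). [cite: ONeillSemiRiemannian1983, Ch. 14, p. 402] -/
theorem raysStayInClosure_of_causalFuture_subset (𝒟 : CauchyDevelopment D) {O : Set 𝒟.carrier}
    (hO : 𝒟.metric.causalFuture 𝒟.timeOrientation (range 𝒟.embed) ⊆ closure O) :
    RaysStayInClosure 𝒟 O := by
  intro _ p γ dom hray _ t ht ht0
  exact hO (hray.mem_causalFuture_range ht ht0)

/-- `RaysStayInClosure 𝒟 (J⁺(ι X))` in every Cauchy development. [cite: ONeillSemiRiemannian1983, Ch. 14, p. 402] -/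
theorem raysStayInClosure_causalFuture_range (𝒟 : CauchyDevelopment D) :
    RaysStayInClosure 𝒟 (𝒟.metric.causalFuture 𝒟.timeOrientation (range 𝒟.embed)) :=
  raysStayInClosure_of_causalFuture_subset 𝒟 subset_closure

/-- Future orientation of a final-state decomposition rides along a time-orientation preserving
isometric diffeomorphism (chain rule + timecone lemma). [cite: ONeillSemiRiemannian1983, Ch. 5, p. 145] -/
private theorem isFutureOriented_transport {𝓢₁ 𝓢₂ : Spacetime.{0} 4}
    (ψ : Diffeomorph (𝓡 4) (𝓡 4) 𝓢₁.carrier 𝓢₂.carrier ∞)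
    (hiso : 𝓢₁.metric.IsIsometry 𝓢₂.metric.toPseudoRiemannianMetric ψ)
    (hτ : 𝓢₁.timeOrientation.PreservesTimeOrientation ψ 𝓢₂.timeOrientation)
    {O : Set 𝓢₁.carrier} {k : ℕ} (d : FinalStateDecomposition 𝓢₁ O k) (h : IsFutureOriented d) :
    IsFutureOriented (transportDecomposition ψ hiso hτ d) := by
  have step : ∀ {U : Opens E4} {Ψ : U → 𝓢₁.carrier}, ContMDiff 𝓘(ℝ, E4) (𝓡 4) ∞ Ψ →
      ∀ {x : U} {v : E4}, 𝓢₁.timeOrientation.IsFutureDirected (mfderiv 𝓘(ℝ, E4) (𝓡 4) Ψ x v) →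
        𝓢₂.timeOrientation.IsFutureDirected (mfderiv 𝓘(ℝ, E4) (𝓡 4) (ψ ∘ Ψ) x v) := by
    intro U Ψ hΨ x v hv
    have hc : MDifferentiableAt 𝓘(ℝ, E4) (𝓡 4) Ψ x := (hΨ.mdifferentiable (by simp)) x
    rw [mfderiv_comp x (mdifferentiable_diffeomorph ψ _) hc]
    exact hτ.isFutureDirected_mfderiv hiso hv
  obtain ⟨h₁, h₂, h₃⟩ := h
  refine ⟨h₁, fun i ρ ↦ (h₂ i ρ).mono fun τ hτ' x hx ↦ ?_, h₃.mono fun τ hτ' x hx ↦ ?_⟩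
  · exact step (d.isLateChart i).contMDiff (hτ' x hx)
  · exact step d.isLateChart_flat.contMDiff (hτ' x hx)

/-- **`SettlesT2` with `O = J⁺(ι X)` rides along isometries of developments**: complete `𝓘⁺`
(`hasCompleteNullInfinity_iff_of_isIsometricTo`), the decomposition (`transportDecomposition`,
`ψ(O) = exteriorOf 𝒟₂ ψ(charted)` by `image_exteriorOf`), exhaustiveness, future orientation; the ray
clause is automatic in the target since `ψ(J⁺(ι₁ X)) = J⁺(ι₂ X)` (`image_causalFuture_eq`,
`raysStayInClosure_causalFuture_range`). [cite: Ringstrom2009, Thm. 16.6] -/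
theorem settlesT2_of_isIsometricTo_of_causalFuture {𝒟₁ 𝒟₂ : VacuumCauchyDevelopment D}
    (h : 𝒟₁.toCauchyDevelopment.IsIsometricTo 𝒟₂.toCauchyDevelopment)
    (hI : HasCompleteNullInfinity 𝒟₁.toCauchyDevelopment)
    (d : FinalStateDecomposition 𝒟₁.toSpacetime
      (𝒟₁.metric.causalFuture 𝒟₁.timeOrientation (range 𝒟₁.embed)) 2)
    (hsub : ∀ i, Kerr.IsSubextremal (d.mass i) (d.spin i))
    (hO : 𝒟₁.metric.causalFuture 𝒟₁.timeOrientation (range 𝒟₁.embed) =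
      exteriorOf 𝒟₁.toCauchyDevelopment d.charted)
    (hex : HasExhaustiveCharts d) (hfo : IsFutureOriented d) : SettlesT2 𝒟₂ := by
  refine ⟨(hasCompleteNullInfinity_iff_of_isIsometricTo _ _ h).1 hI, ?_⟩
  obtain ⟨ψ, hiso, hτ, hι⟩ := h
  refine ⟨ψ '' 𝒟₁.metric.causalFuture 𝒟₁.timeOrientation (range 𝒟₁.embed),
    transportDecomposition (𝓢₁ := 𝒟₁.toSpacetime) (𝓢₂ := 𝒟₂.toSpacetime) ψ hiso hτ d, hsub, ?_, ?_,
    hasExhaustiveCharts_transportDecomposition _ hiso hτ d hex, isFutureOriented_transport ψ hiso hτ d hfo⟩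
  · rw [charted_transportDecomposition, ← image_exteriorOf ψ hiso hτ hι, ← hO]
  · rw [image_causalFuture_eq (𝓢₁ := 𝒟₁.toSpacetime) (𝓢₂ := 𝒟₂.toSpacetime) ψ hiso hτ,
      ← range_comp, hι]
    exact raysStayInClosure_causalFuture_range 𝒟₂.toCauchyDevelopment

/-! ## §3 Minkowski space settles w.r.t. any data hypersurface below a hyperplane -/

/-- **The T2 package of a vacuum Cauchy development WHICH IS Minkowski space**, w.r.t. its own data
hypersurface `ι(X)` — an ARBITRARY Cauchy hypersurface of `(ℝ⁴, η)` below some hyperplane `{x⁰ = T}`: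
complete `𝓘⁺` (`minkowski_hasCompleteFutureNullInfinity_of_normalField`) and the honest `N = 0`
decomposition of `O := J⁺(ι X)` by the identity flat chart after `τ₀ = T` (`exists_lateFlatDecomp`,
`lateHalfSpace_subset_causalFuture`), with `O = J⁺(ι X) ∩ I⁻({x⁰ > T}) = exteriorOf`
(`chronologicalPast_late`), exhaustive and future-oriented. [cite: ChristodoulouKlainerman1993, Thm. 1.0.2] -/
theorem exists_decomp_causalFuture_of_toSpacetime_eq_minkowski (𝒟 : VacuumCauchyDevelopment D)
    (h𝒟 : 𝒟.toSpacetime = Minkowski.spacetime)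
    (hT : ∃ T : ℝ, ∀ p : X,
      (cast (congrArg LorentzianManifold.carrier (congrArg Spacetime.toLorentzianManifold h𝒟))
        (𝒟.embed p) : E4) 0 ≤ T) :
    HasCompleteNullInfinity 𝒟.toCauchyDevelopment ∧
      ∃ d : FinalStateDecomposition 𝒟.toSpacetime
          (𝒟.metric.causalFuture 𝒟.timeOrientation (range 𝒟.embed)) 2,
        (∀ i, Kerr.IsSubextremal (d.mass i) (d.spin i)) ∧
          𝒟.metric.causalFuture 𝒟.timeOrientation (range 𝒟.embed) =
              exteriorOf 𝒟.toCauchyDevelopment d.charted ∧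
            HasExhaustiveCharts d ∧ IsFutureOriented d := by
  obtain ⟨⟨⟨S, ι, hι, ν, hν, hh, hk⟩, hC⟩, hRic⟩ := 𝒟
  dsimp only at h𝒟
  subst h𝒟
  obtain ⟨T, hT⟩ := hT
  replace hT : ∀ p : X, @id E4 (ι p) 0 ≤ T := fun p ↦ hT p
  have hO : {x : E4 | T < x 0} ⊆
      Minkowski.spacetime.metric.causalFuture Minkowski.spacetime.timeOrientation (range ι) :=
    lateHalfSpace_subset_causalFuture hC fun x hx ↦ by
      obtain ⟨p, rfl⟩ := hx
      exact hT p
  obtain ⟨d, hN, hcharted, hex, hfo⟩ := exists_lateFlatDecomp _ T hO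
  refine ⟨?_, d, ?_, ?_, hex, hfo⟩
  · -- complete `𝓘⁺` w.r.t. the arbitrary data hypersurface `ι(X)`
    intro inst
    exact @minkowski_hasCompleteFutureNullInfinity_of_normalField X _ ι ν inst
  · -- no hole: sub-extremality is vacuous
    intro i
    exact absurd i.is_lt (by omega)
  · -- `J⁺(ι X) = J⁺(ι X) ∩ I⁻({x⁰ > T}) = exteriorOf 𝒟 charted`, as `I⁻({x⁰ > T}) = ℝ⁴`
    refine Set.ext fun x ↦ ⟨fun hx ↦ ⟨hx, ?_⟩, fun hx ↦ hx.1⟩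
    rw [hcharted]
    exact (Set.ext_iff.mp (chronologicalPast_late T) x).mpr (mem_univ x)

/-- **A vacuum Cauchy development WHICH IS Minkowski space, its data hypersurface below a hyperplane,
settles in the T2 sense** (`SettlesT2`, with `O = J⁺(ι X)`; rays from the data stay in `J⁺(ι X)`,
`raysStayInClosure_causalFuture_range`). The member `X = ℝ³`, `ι = {t = 0}`, `T = 0` is
`TrivialDatum.settlesT2_minkowski`. Christodoulou–Klainerman 1993, Thm. 1.0.2.
[cite: ChristodoulouKlainerman1993, Thm. 1.0.2] -/
theorem settlesT2_of_toSpacetime_eq_minkowski (𝒟 : VacuumCauchyDevelopment D)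
    (h𝒟 : 𝒟.toSpacetime = Minkowski.spacetime)
    (hT : ∃ T : ℝ, ∀ p : X,
      (cast (congrArg LorentzianManifold.carrier (congrArg Spacetime.toLorentzianManifold h𝒟))
        (𝒟.embed p) : E4) 0 ≤ T) :
    SettlesT2 𝒟 := by
  obtain ⟨hI, d, hsub, hO, hex, hfo⟩ := exists_decomp_causalFuture_of_toSpacetime_eq_minkowski 𝒟 h𝒟 hT
  exact ⟨hI, _, d, hsub, hO, raysStayInClosure_causalFuture_range _, hex, hfo⟩

/-- **A datum with a Cauchy development WHICH IS Minkowski space, its slice below a hyperplane, is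
SETTLED**: every maximal vacuum Cauchy development of it has complete `𝓘⁺` and an honest sub-extremal
(`N = 0`) decomposition of `O = exteriorOf` with rays staying, exhaustive future-oriented charts
(`SettlesT2`): the Minkowskian development is vacuum and geodesically complete, so every maximal
vacuum development is isometric to it as a development (`IsMaximal.isIsometricTo_of_isGeodesicallyComplete`,
O'Neill 1983, Cor. 7.29; Choquet-Bruhat–Geroch 1969, Thm. 3), and the T2 package rides along
(`settlesT2_of_isIsometricTo_of_causalFuture`). [cite: ChoquetBruhatGeroch1969CMP, Thm. 3 (pp. 332–334)] -/
theorem settled_of_cauchyDevelopment_eq_minkowski (𝒟 : CauchyDevelopment D)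
    (h𝒟 : 𝒟.toSpacetime = Minkowski.spacetime)
    (hT : ∃ T : ℝ, ∀ p : X,
      (cast (congrArg LorentzianManifold.carrier (congrArg Spacetime.toLorentzianManifold h𝒟))
        (𝒟.embed p) : E4) 0 ≤ T) :
    ∀ 𝒟' : VacuumCauchyDevelopment D, 𝒟'.IsMaximal → SettlesT2 𝒟' := by
  obtain ⟨⟨S, ι, hι, ν, hν, hh, hk⟩, hC⟩ := 𝒟
  dsimp only at h𝒟
  subst h𝒟
  intro 𝒟' h𝒟'
  let 𝒟ᵥ : VacuumCauchyDevelopment D :=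
    ⟨⟨⟨Minkowski.spacetime, ι, hι, ν, hν, hh, hk⟩, hC⟩, @Minkowski.isRicciFlat_holds⟩
  have hc : ∀ [𝒟ᵥ.metric.toPseudoRiemannianMetric.HasLeviCivita],
      IsGeodesicallyComplete 𝒟ᵥ.metric.toPseudoRiemannianMetric.leviCivita :=
    @Minkowski.isGeodesicallyComplete_smoothMetric
  obtain ⟨hI, d, hsub, hO, hex, hfo⟩ :=
    exists_decomp_causalFuture_of_toSpacetime_eq_minkowski 𝒟ᵥ rfl hT
  exact settlesT2_of_isIsometricTo_of_causalFuture (h𝒟'.isIsometricTo_of_isGeodesicallyComplete hc)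
    hI d hsub hO hex hfo

end AnyDevelopment

/-! ## §4 The consequent of `C₂` at Minkowskian bases

The model point — every MGHD of the trivial datum settles, the tree's `TrivialDatum.settlesT2_of_isMaximal` —
is the case `ι = {t = 0}`, `T = 0` of `settled_of_cauchyDevelopment_eq_minkowski` (not restated). -/

/-- **Through every ADMISSIBLE datum with a Cauchy development which is Minkowski space, its slice
below a hyperplane, passes a tame, injective, immersed curve of admissible data all of whose members
off `0` are SETTLED** — the consequent of `C₂ = SettlingAlongCensoredKerrEnds` at every input curve with
such a base `F 0 = d` (the hypotheses of `C₂` on the members off `0` are idle): the datum is settled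
(`settled_of_cauchyDevelopment_eq_minkowski`) and its breathing curve is the witness. [cite: Christodoulou1999, p. A24] -/
theorem exists_settledCurve_of_cauchyDevelopment_eq_minkowski :
    ∀ (X : Type) [TopologicalSpace X] [ChartedSpace E3 X] [IsManifold (𝓡 3) ∞ X] [T2Space X]
      [SecondCountableTopology X] [ConnectedSpace X], ∀ d ∈ admissibleVacuumData X,
      ∀ (𝒟 : CauchyDevelopment d) (h𝒟 : 𝒟.toSpacetime = Minkowski.spacetime),
        (∃ T : ℝ, ∀ p : X,
          (cast (congrArg LorentzianManifold.carrier (congrArg Spacetime.toLorentzianManifold h𝒟))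
            (𝒟.embed p) : E4) 0 ≤ T) →
        ∃ (e' : AFEnd X) (F' : EuclideanSpace ℝ (Fin 1) → InitialDataSet (𝓡 3) X),
          InitialDataSet.IsTameDataFamily e' 1 F' ∧ F' 0 = d ∧ Injective F' ∧
            InitialDataSet.IsImmersedAtZero 1 F' ∧ (∀ c, F' c ∈ admissibleVacuumData X) ∧
              ∀ c : EuclideanSpace ℝ (Fin 1), c ≠ 0 →
                ∀ 𝒟' : VacuumCauchyDevelopment (F' c), 𝒟'.IsMaximal →
                  HasCompleteNullInfinity 𝒟'.toCauchyDevelopment ∧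
                    ∃ (O : Set 𝒟'.carrier) (dd : FinalStateDecomposition 𝒟'.toSpacetime O 2),
                      (∀ i, Kerr.IsSubextremal (dd.mass i) (dd.spin i)) ∧
                        O = exteriorOf 𝒟'.toCauchyDevelopment dd.charted ∧
                          RaysStayInClosure 𝒟'.toCauchyDevelopment O ∧ HasExhaustiveCharts dd ∧
                            IsFutureOriented dd := by
  intro X _ _ _ _ _ _ d hd 𝒟 h𝒟 hT
  obtain ⟨-, e, M, hsole, hdecay⟩ := id hd
  exact settledSelfWitness X e d (InitialDataSet.isTameDataFamily_const hsole 1 hdecay) hd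
    fun 𝒟' h𝒟' ↦ settled_of_cauchyDevelopment_eq_minkowski 𝒟 h𝒟 hT 𝒟' h𝒟'

end Summit.FinalStateConjecture.FinalStateConjecture.Theorems.ExactKerrEnds

end
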